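import Mathlib
import HarnessLib
import Literature.Computability.AlgebraicComplexity.PatternExpressions
import Literature.Computability.AlgebraicComplexity.ArithCircuitProofs
import Summits.ValiantsHypothesis.ValiantsHypothesis.Theorems.MonotoneRestorationOrbitCompressionQPOneRowStratum

/-!
# Route MonotoneRestoration — aside `OrbitCompressionQP` (stmt-ValiantsHypothesis-18332), line
# `expression_compression`: the one-row stratum AS A LITERAL SUB-CASE of `stub_narrowExpressionCompression`

`Theorems/…OneRowStratum.lean` proves the one-row stratum `f_n = Σ_i g_n(row i)` under the hypothesis that
the ROW polynomial family `g` is `VQP`.  The stub's hypothesis is on `f` itself (`IsVPFamily f`).  The two are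
equivalent up to the quasi-polynomial scale: `n • g_n = f_n(x_{ij} ↦ y_j)` (every row replaced by the same
vector), a renaming, so `L(g_n) ≤ L(f_n) + 1` and `deg g_n ≤ deg f_n`.

* `rename_snd_oneRow` — `rename Prod.snd f_n = n • g_n`;
* `isVQPFamily_row_of_oneRow` — `f ∈ VQP ⇒ g ∈ VQP` (`complexity_rename_le`, `complexity_smul_le`, both
  discharged in the tree; `MvPolynomial.totalDegree_rename_le`);
* ★★ `narrowQP_oneRow_of_family_VQP` / `…_of_family_VP` — for every family of symmetric row polynomials
  `g_n`, if `f = (Σ_i g_n(row i))_n` is `VQP` (in particular `VP`, as in the stub), then `f` is narrow of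
  quasi-polynomial length: the one-row stratum of `stub_narrowExpressionCompression` with the stub's own
  hypotheses (matrix symmetry holds by `oneRow_matrixSymmetric`; the hypothesis "narrow of some length" is
  not needed).

Helper file (`--supports stmt-ValiantsHypothesis-18332`); def-free; nothing here is a named fact; no registered
stub is closed; VP ≠ VNP is not moved.
-/

noncomputable section

open MvPolynomial

-- `Summit.ValiantsHypothesis.ValiantsHypothesis.…` is the tree's single-conjunct layout (Sub = Summit).
set_option linter.dupNamespace false

namespace Summit.ValiantsHypothesis.ValiantsHypothesis.Theorems

namespace FormulaSubstitution

open Literature.Computability.AlgebraicComplexity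

/-- **Collapsing all rows onto one**: `rename Prod.snd (Σ_i g(row i)) = n • g`. [folklore] -/
theorem rename_snd_oneRow {n : ℕ} (g : MvPolynomial (Fin n) ℂ) :
    rename Prod.snd (∑ i : Fin n, aeval (fun v : Fin n => (X (i, v) : MvPolynomial (Fin n × Fin n) ℂ)) g) =
      n • g := by
  rw [map_sum]
  have hterm : ∀ i : Fin n,
      rename Prod.snd (aeval (fun v : Fin n => (X (i, v) : MvPolynomial (Fin n × Fin n) ℂ)) g) = g := by
    intro i
    rw [← AlgHom.comp_apply, comp_aeval]
    have hfun : (fun v : Fin n => rename Prod.snd (X (i, v) : MvPolynomial (Fin n × Fin n) ℂ)) =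
        fun v : Fin n => (X v : MvPolynomial (Fin n) ℂ) := funext fun v => by rw [rename_X]
    rw [hfun, aeval_X_left, AlgHom.id_apply]
  simp_rw [hterm]
  rw [Finset.sum_const, Finset.card_univ, Fintype.card_fin]

/-- **The row polynomials of a `VQP` one-row family form a `VQP` family.** [folklore] -/
theorem isVQPFamily_row_of_oneRow (g : (n : ℕ) → MvPolynomial (Fin n) ℂ)
    (hf : IsVQPFamily fun n =>
      ∑ i : Fin n, aeval (fun v : Fin n => (X (i, v) : MvPolynomial (Fin n × Fin n) ℂ)) (g n)) :
    IsVQPFamily g := by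
  obtain ⟨⟨_, hdeg⟩, hL⟩ := hf
  -- `g_n = (n⁻¹ : ℂ) • rename Prod.snd f_n` for `n ≥ 1`
  have hg : ∀ n : ℕ, 1 ≤ n → g n = ((n : ℂ)⁻¹) • rename Prod.snd
      (∑ i : Fin n, aeval (fun v : Fin n => (X (i, v) : MvPolynomial (Fin n × Fin n) ℂ)) (g n)) := by
    intro n hn
    have hn0 : (n : ℂ) ≠ 0 := by exact_mod_cast (show n ≠ 0 by omega)
    rw [rename_snd_oneRow, ← Nat.cast_smul_eq_nsmul ℂ, smul_smul, inv_mul_cancel₀ hn0, one_smul]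
  refine ⟨⟨IsPBounded.id.mono fun n => by simp, hdeg.mono fun n => ?_⟩, ?_⟩
  · rcases Nat.eq_zero_or_pos n with h0 | hpos
    · subst h0
      have : g 0 = C (constantCoeff (g 0)) := by
        refine (MvPolynomial.eq_C_of_isEmpty (g 0))
      rw [this, totalDegree_C]
      exact Nat.zero_le _
    · rw [hg n hpos]
      exact (totalDegree_smul_le _ _).trans (totalDegree_rename_le _ _)
  · refine (hL.add (IsQPBounded.const 1)).mono fun n => ?_
    rcases Nat.eq_zero_or_pos n with h0 | hpos
    · subst h0
      have : g 0 = C (constantCoeff (g 0)) := MvPolynomial.eq_C_of_isEmpty (g 0)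
      rw [this, complexity_C_holds]
      exact Nat.zero_le _
    · conv_lhs => rw [hg n hpos]
      exact (complexity_smul_le_holds _ _).trans
        (Nat.add_le_add_right (complexity_rename_le_holds' _ _) 1)

/-- ★★ **The one-row stratum of `stub_narrowExpressionCompression`, with the stub's own hypothesis on the
family.**  For every family of SYMMETRIC row polynomials `g_n ∈ ℂ[x_0, …, x_{n-1}]`: if the matrix-symmetric
family `f_n = Σ_i g_n(x_{i,0}, …, x_{i,n-1})` is `VQP`, then `f` is narrow of quasi-polynomial length.
[cite: BlaserJindal2019, Thm. 4] -/
theorem narrowQP_oneRow_of_family_VQP (g : (n : ℕ) → MvPolynomial (Fin n) ℂ)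
    (hsymm : ∀ n, (g n).IsSymmetric)
    (hf : IsVQPFamily fun n =>
      ∑ i : Fin n, aeval (fun v : Fin n => (X (i, v) : MvPolynomial (Fin n × Fin n) ℂ)) (g n)) :
    ∃ c : ℕ, ∀ n : ℕ, 1 ≤ n → ∃ (k l : ℕ) (e : PatternExpr ℂ k l),
      n ^ (k + l) ≤ 2 ^ ((Nat.log 2 n + c) ^ c) ∧ e.length ≤ 2 ^ ((Nat.log 2 n + c) ^ c) ∧
      e.close n = ∑ i : Fin n,
        aeval (fun v : Fin n => (X (i, v) : MvPolynomial (Fin n × Fin n) ℂ)) (g n) :=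
  narrowQP_oneRow g hsymm (isVQPFamily_row_of_oneRow g hf)

/-- The `VP` case: the one-row stratum with LITERALLY the stub's hypothesis `IsVPFamily f`.
[cite: BlaserJindal2019, Thm. 4] -/
theorem narrowQP_oneRow_of_family_VP (g : (n : ℕ) → MvPolynomial (Fin n) ℂ)
    (hsymm : ∀ n, (g n).IsSymmetric)
    (hf : IsVPFamily fun n =>
      ∑ i : Fin n, aeval (fun v : Fin n => (X (i, v) : MvPolynomial (Fin n × Fin n) ℂ)) (g n)) :
    ∃ c : ℕ, ∀ n : ℕ, 1 ≤ n → ∃ (k l : ℕ) (e : PatternExpr ℂ k l),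
      n ^ (k + l) ≤ 2 ^ ((Nat.log 2 n + c) ^ c) ∧ e.length ≤ 2 ^ ((Nat.log 2 n + c) ^ c) ∧
      e.close n = ∑ i : Fin n,
        aeval (fun v : Fin n => (X (i, v) : MvPolynomial (Fin n × Fin n) ℂ)) (g n) :=
  narrowQP_oneRow_of_family_VQP g hsymm hf.isVQPFamily

/-- ★★ **`stub_narrowExpressionCompression` restricted to the one-row stratum**, in the stub's exact shape:
for every family `f` of the form `f_n = Σ_i g_n(row i)` with `g_n` symmetric, the stub's implication holds
(matrix symmetry and "narrow of some length" are in fact not needed). [cite: BlaserJindal2019, Thm. 4] -/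
theorem narrowExpressionCompression_oneRow (g : (n : ℕ) → MvPolynomial (Fin n) ℂ)
    (hsymm : ∀ n, (g n).IsSymmetric) :
    let f : (n : ℕ) → MvPolynomial (Fin n × Fin n) ℂ := fun n =>
      ∑ i : Fin n, aeval (fun v : Fin n => (X (i, v) : MvPolynomial (Fin n × Fin n) ℂ)) (g n)
    (∀ (n : ℕ) (σ τ : Equiv.Perm (Fin n)),
        MvPolynomial.rename (fun p : Fin n × Fin n => (σ p.1, τ p.2)) (f n) = f n) →
      IsVPFamily f →
      (∃ c : ℕ, ∀ n : ℕ, 1 ≤ n → ∃ (k l : ℕ) (e : PatternExpr ℂ k l),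
        n ^ (k + l) ≤ 2 ^ ((Nat.log 2 n + c) ^ c) ∧ e.close n = f n) →
      ∃ c : ℕ, ∀ n : ℕ, 1 ≤ n → ∃ (k l : ℕ) (e : PatternExpr ℂ k l),
        n ^ (k + l) ≤ 2 ^ ((Nat.log 2 n + c) ^ c) ∧ e.length ≤ 2 ^ ((Nat.log 2 n + c) ^ c) ∧
        e.close n = f n := by
  intro f _ hVP _
  exact narrowQP_oneRow_of_family_VP g hsymm hVP

end FormulaSubstitution

end Summit.ValiantsHypothesis.ValiantsHypothesis.Theorems

end
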